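import Summits.BirchSwinnertonDyer.BirchSwinnertonDyer.Theorems.ClassRecordThreeEulerHalvesAtThreeCartanCoverEisenstein
import HarnessLib

/-!
# Crux NUM `CartanOnePlaceDegreeLawAtThree` (item 24801), line `lattice` — brick 2′: the EISENSTEIN CONGRUENCE for a GENERAL torus quotient
# (any commutative residue algebra `𝔽_q[E]`, any level group inside `ι(O₀'¹)`, coset data given as a finite family)

Seat `bsd-stepL-tam3-p1` g27 (LEAD of crux 24801; `--supports stmt-BirchSwinnertonDyer-24801 --as helper`). Brick 2 (`Eisenstein.card_smul_period_sub_sum_mem`, p732605)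
is the case `E = η` (non-split torus, level group `X.Gamma`, coset data from `X.heckeSet`). For the SPLIT-SIDE descent (D3_S, `CartanCover.DescentSplitAtThree`) the same
computation is needed with `E = E₀₀` (diagonal torus, level group `Γ_{T_s} = R.levelOf T_s`) and with coset data TRANSPORTED from a presentation `X'` of level
`(D, Mq²; C∖q)` along a conjugator — so this file states the congruence for an ARBITRARY matrix `E`, an arbitrary subgroup `Γ' ≤ ι(O₀'¹)` and an abstract finite family:
given `y, x_i, d_i ∈ O₀'` with residues in the commutative algebra `𝔽_q[E]`, `det ι(x_i) = n` prime to `q`, `ι(y) = γ ∈ Γ'`, `ι(d_i) = δ_i ∈ Γ'`, a permutation `e` with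
`x_i y = d_i x_{e i}`, and a weight-two form `F` on `Γ'` whose `Γ̄(q)`-periods lie in `N`: **`#ι · ∫^γ F − Σ_i ∫^{δ_i} F ∈ N`** (`card_smul_period_sub_sum_mem_family`).
Proof = brick 2 §c–§e verbatim over `𝔽_q[E]`. Elementary; nothing about NUM or any curve is proved; BSD is proved for no curve.
[cite: Mazur1977, §II.11] [cite: ShimuraIATAF1971, §3.3 and §8.3 (8.3.2)]
-/

set_option linter.dupNamespace false
set_option autoImplicit false

noncomputable section

open scoped MatrixGroups ModularForm IsMulCommutative
open UpperHalfPlane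

namespace Summit.BirchSwinnertonDyer.BirchSwinnertonDyer.Theorems.CartanCover

open Literature.NumberTheory.Automorphic

variable {D M : ℕ} {C : Finset ℕ} {X : CartanLevelCurveData D M C} {q : ℕ}

namespace CoverReduction

variable [Fact q.Prime] (R : CoverReduction X q)

/-! ## §1 Residues in a commutative algebra `𝔽_q[E]` -/

/-- `red y`, for `y ∈ O₀'` with residue in `𝔽_q[E]`, as an element of the commutative algebra `𝔽_q[E]`. -/
def redE (E : Matrix (Fin 2) (Fin 2) (ZMod q)) (y : coverSubring X q) (hy : R.red y ∈ Algebra.adjoin (ZMod q) {E}) :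
    Algebra.adjoin (ZMod q) ({E} : Set (Matrix (Fin 2) (Fin 2) (ZMod q))) := ⟨R.red y, hy⟩

/-- `redE` as a matrix is `red`. -/
@[simp] theorem coe_redE (E : Matrix (Fin 2) (Fin 2) (ZMod q)) (y : coverSubring X q) (hy : R.red y ∈ Algebra.adjoin (ZMod q) {E}) :
    (R.redE E y hy : Matrix (Fin 2) (Fin 2) (ZMod q)) = R.red y := rfl

/-- An element of `𝔽_q[E]` with invertible determinant is a unit of `𝔽_q[E]` (finite algebra, injective multiplication). [folklore] -/
theorem isUnit_adjoin_of_isUnit_det (E : Matrix (Fin 2) (Fin 2) (ZMod q)) {m : Algebra.adjoin (ZMod q) ({E} : Set (Matrix (Fin 2) (Fin 2) (ZMod q)))}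
    (hm : IsUnit (m : Matrix (Fin 2) (Fin 2) (ZMod q)).det) : IsUnit m := by
  have hmu : IsUnit (m : Matrix (Fin 2) (Fin 2) (ZMod q)) := (Matrix.isUnit_iff_isUnit_det _).mpr hm
  haveI : Finite (Algebra.adjoin (ZMod q) ({E} : Set (Matrix (Fin 2) (Fin 2) (ZMod q)))) :=
    Finite.of_injective (fun k : Algebra.adjoin (ZMod q) ({E} : Set (Matrix (Fin 2) (Fin 2) (ZMod q))) => (k : Matrix (Fin 2) (Fin 2) (ZMod q)))
      Subtype.val_injective
  have hinj : Function.Injective (fun k : Algebra.adjoin (ZMod q) ({E} : Set (Matrix (Fin 2) (Fin 2) (ZMod q))) => m * k) := by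
    intro k k' hkk'
    have h := congrArg (fun z : Algebra.adjoin (ZMod q) ({E} : Set (Matrix (Fin 2) (Fin 2) (ZMod q))) => (z : Matrix (Fin 2) (Fin 2) (ZMod q))) hkk'
    simp only [Subalgebra.coe_mul] at h
    exact Subtype.ext (hmu.mul_right_injective h)
  obtain ⟨k, hk⟩ := (Finite.injective_iff_surjective.mp hinj) 1
  exact isUnit_iff_exists_inv.mpr ⟨k, hk⟩

/-- `red y` is a unit of `𝔽_q[E]` when `det ι(y) = n` is prime to `q`. -/
theorem isUnit_redE_of_det (E : Matrix (Fin 2) (Fin 2) (ZMod q)) (y : coverSubring X q) (hy : R.red y ∈ Algebra.adjoin (ZMod q) {E})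
    {n : ℕ} (hn : ¬ q ∣ n) (hdet : (X.ι (y : X.B)).det = n) : IsUnit (R.redE E y hy) := by
  refine isUnit_adjoin_of_isUnit_det E ?_
  obtain ⟨m, hm, hdet'⟩ := R.det_red y
  have hmn : m = n := by
    have h := AlgHom.det_eq_reducedNorm X.ι (y : X.B)
    rw [hdet, hm] at h
    have h' : ((n : ℚ) : ℝ) = ((m : ℚ) : ℝ) := by rw [Rat.cast_natCast]; exact h
    exact_mod_cast h'.symm
  rw [coe_redE, hdet', hmn, Int.cast_natCast, isUnit_iff_ne_zero, Ne, ZMod.natCast_eq_zero_iff]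
  exact hn

end CoverReduction

namespace Eisenstein

/-! ## §2 Periods on a general level group: additivity over lists -/

/-- `∫_z^{(∏ l) z} F = Σ_{g ∈ l} ∫_z^{g z} F` for a list of elements of a subgroup `Γ' ≤ SL₂(ℝ)` and a weight-two form on `Γ'`
(`Γ'`-invariance of segment integrals: tree `CartanDegree.segmentIntegral_slash_inv_smul`). [cite: ShimuraIATAF1971, §8.2 (8.2.20)] -/
theorem period_list_prod_of_subgroup {Γ' : Subgroup (GL (Fin 2) ℝ)} [Γ'.HasDetOne] (F : CuspForm Γ' 2) (z : ℍ) :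
    ∀ l : List (GL (Fin 2) ℝ), (∀ g ∈ l, g ∈ Γ') →
      segmentIntegral F z (l.prod • z) = (l.map fun g => segmentIntegral F z (g • z)).sum := by
  have hinv : ∀ {δ : GL (Fin 2) ℝ}, δ ∈ Γ' → ∀ z' w' : ℍ, segmentIntegral F (δ • z') (δ • w') = segmentIntegral F z' w' := by
    intro δ hδ z' w'
    have hdet : 0 < δ.det.val := by rw [Subgroup.HasDetOne.det_eq hδ, Units.val_one]; exact one_pos
    have h := CartanDegree.segmentIntegral_slash_inv_smul F hdet (δ • z') w'
    rw [inv_smul_smul, SlashInvariantForm.slash_action_eqn F δ hδ] at h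
    exact h.symm
  have hmul : ∀ {γ : GL (Fin 2) ℝ}, γ ∈ Γ' → ∀ δ : GL (Fin 2) ℝ,
      segmentIntegral F z ((γ * δ) • z) = segmentIntegral F z (γ • z) + segmentIntegral F z (δ • z) := by
    intro γ hγ δ
    rw [mul_smul]
    have eC := segmentIntegral_sub_segmentIntegral F z (γ • z) (γ • δ • z)
    have eB := hinv hγ z (δ • z)
    linear_combination eC + eB
  intro l hl
  induction l with
  | nil =>
    simp only [List.prod_nil, one_smul, List.map_nil, List.sum_nil]
    have e := segmentIntegral_sub_segmentIntegral F z z z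
    rw [sub_self] at e
    exact e.symm
  | cons g l ih =>
    rw [List.prod_cons, List.map_cons, List.sum_cons, hmul (hl g (by simp)), ih (fun g' hg' => hl g' (by simp [hg']))]

/-! ## §3 The congruence for an abstract family -/

/-- **THE EISENSTEIN CONGRUENCE (family form).** Let `R` be a reduction datum at `q`, `E` any matrix, `Γ' ≤ ι(O₀'¹)` a subgroup, `F ∈ S₂(Γ')` with all
`Γ̄(q)`-periods in `N`; let `y, x_i, d_i ∈ O₀'` (`i` in a finite type) have residues in `𝔽_q[E]`, with `ι(y) = γ ∈ Γ'`, `ι(d_i) = δ_i ∈ Γ'`, `det ι(x_i) = n`,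
`q ∤ n`, and `x_i y = d_i x_{e i}` for a permutation `e`. Then `#ι · ∫_z^{γz} F − Σ_i ∫_z^{δ_i z} F ∈ N`. [cite: Mazur1977, §II.11] [cite: ShimuraIATAF1971, §3.3] -/
theorem card_smul_period_sub_sum_mem_family [Fact q.Prime] (R : CoverReduction X q) (E : Matrix (Fin 2) (Fin 2) (ZMod q))
    {Γ' : Subgroup (GL (Fin 2) ℝ)} [Γ'.HasDetOne] (hΓ' : Γ' ≤ coverUnits X q)
    (F : CuspForm Γ' 2) (N : AddSubgroup ℂ) (hN : ∀ g ∈ principalLevel X q, ∀ z : ℍ, segmentIntegral F z (g • z) ∈ N)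
    {n : ℕ} (hn : ¬ q ∣ n) {ι : Type*} [Fintype ι]
    (y : coverSubring X q) (hy : R.red y ∈ Algebra.adjoin (ZMod q) {E}) {γ : GL (Fin 2) ℝ} (hγ : γ ∈ Γ')
    (hyγ : X.ι (y : X.B) = (γ : Matrix (Fin 2) (Fin 2) ℝ))
    (x : ι → coverSubring X q) (hx : ∀ i, R.red (x i) ∈ Algebra.adjoin (ZMod q) {E}) (hxdet : ∀ i, (X.ι (x i : X.B)).det = n)
    (d : ι → coverSubring X q) (hd : ∀ i, R.red (d i) ∈ Algebra.adjoin (ZMod q) {E}) (δ : ι → GL (Fin 2) ℝ) (hδ : ∀ i, δ i ∈ Γ')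
    (hdδ : ∀ i, X.ι (d i : X.B) = ((δ i : GL (Fin 2) ℝ) : Matrix (Fin 2) (Fin 2) ℝ))
    (e : ι ≃ ι) (hrel : ∀ i, x i * y = d i * x (e i)) (z : ℍ) :
    (Fintype.card ι : ℂ) * segmentIntegral F z (γ • z) - ∑ i, segmentIntegral F z (δ i • z) ∈ N := by
  classical
  -- §c. in `K = 𝔽_q[E]`: `X_i * Y = D_i * X_{e i}`, hence `Y ^ # = ∏ D_i`
  set Y := R.redE E y hy with hYdef
  set Xr : ι → Algebra.adjoin (ZMod q) ({E} : Set (Matrix (Fin 2) (Fin 2) (ZMod q))) := fun i => R.redE E (x i) (hx i) with hXdef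
  set Dr : ι → Algebra.adjoin (ZMod q) ({E} : Set (Matrix (Fin 2) (Fin 2) (ZMod q))) := fun i => R.redE E (d i) (hd i) with hDdef
  have hrelK : ∀ i, Xr i * Y = Dr i * Xr (e i) := by
    intro i
    apply Subtype.ext
    change R.red (x i) * R.red y = R.red (d i) * R.red (x (e i))
    rw [← map_mul, ← map_mul, hrel i]
  have hprod : (∏ i, Xr i) * Y ^ Fintype.card ι = (∏ i, Dr i) * ∏ i, Xr i := by
    rw [← Finset.card_univ, ← Finset.prod_const, ← Finset.prod_mul_distrib]
    simp_rw [hrelK]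
    rw [Finset.prod_mul_distrib, Equiv.prod_comp e Xr]
  have hXunit : IsUnit (∏ i, Xr i) := IsUnit.prod_iff.mpr fun i _ => R.isUnit_redE_of_det E (x i) (hx i) hn (hxdet i)
  have hpow : Y ^ Fintype.card ι = ∏ i, Dr i := by
    have h := hprod
    rw [mul_comm (∏ i, Dr i)] at h
    exact hXunit.mul_left_cancel h
  -- §d. `redHom (γ ^ # · (∏ δ_i)⁻¹) = 1`
  set L : List ι := Finset.univ.toList with hLdef
  set γU : coverUnits X q := ⟨γ, hΓ' hγ⟩ with hγU
  set δU : ι → coverUnits X q := fun i => ⟨δ i, hΓ' (hδ i)⟩ with hδU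
  have hmatY : ((R.redHom γU : GL (Fin 2) (ZMod q)) : Matrix (Fin 2) (Fin 2) (ZMod q)) = (Y : Matrix (Fin 2) (Fin 2) (ZMod q)) := by
    rw [CartanCover.CoverReduction.coe_redHom, unitLift_eq_of_ι_eq γU ((mem_coverSubring_iff X q).mp y.2) hyγ]
    rfl
  have hmatD : ∀ i, ((R.redHom (δU i) : GL (Fin 2) (ZMod q)) : Matrix (Fin 2) (Fin 2) (ZMod q)) = (Dr i : Matrix (Fin 2) (Fin 2) (ZMod q)) := by
    intro i
    rw [CartanCover.CoverReduction.coe_redHom, unitLift_eq_of_ι_eq (δU i) ((mem_coverSubring_iff X q).mp (d i).2) (hdδ i)]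
    rfl
  have hker : R.redHom (γU ^ Fintype.card ι * ((L.map δU).prod)⁻¹) = 1 := by
    rw [map_mul, map_inv, mul_inv_eq_one, map_pow, map_list_prod]
    apply Units.ext
    rw [Units.val_pow_eq_pow_val, hmatY, ← Units.coeHom_apply, map_list_prod]
    have hL : ((L.map δU).map ⇑R.redHom).map ⇑(Units.coeHom (Matrix (Fin 2) (Fin 2) (ZMod q))) =
        (L.map Dr).map (Algebra.adjoin (ZMod q) ({E} : Set (Matrix (Fin 2) (Fin 2) (ZMod q)))).val := by
      simp only [List.map_map]
      refine List.map_congr_left fun i _ => ?_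
      simp only [Function.comp_apply, Units.coeHom_apply, hmatD, Subalgebra.coe_val]
    rw [hL, ← map_list_prod, hLdef, Finset.prod_map_toList, ← hpow]
    simp
  have hmem : ((γU ^ Fintype.card ι * ((L.map δU).prod)⁻¹ : coverUnits X q) : GL (Fin 2) ℝ) ∈ principalLevel X q :=
    (R.mem_ker_redHom_iff _).mp hker
  -- §e. periods
  have hP := hN _ hmem z
  have hcoe : ((γU ^ Fintype.card ι * ((L.map δU).prod)⁻¹ : coverUnits X q) : GL (Fin 2) ℝ) =
      ((List.replicate (Fintype.card ι) γ) ++ (L.map fun i => (δ i)⁻¹).reverse).prod := by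
    rw [Subgroup.coe_mul, Subgroup.coe_pow, Subgroup.coe_inv, Subgroup.val_list_prod, List.map_map, List.prod_append, List.prod_replicate,
      List.prod_inv_reverse, List.map_map]
    rfl
  rw [hcoe, period_list_prod_of_subgroup F z] at hP
  · rw [List.map_append, List.sum_append, List.map_replicate, List.sum_replicate, List.map_reverse, List.sum_reverse, List.map_map] at hP
    have hinv : ∀ {δ' : GL (Fin 2) ℝ}, δ' ∈ Γ' → ∀ z' w' : ℍ, segmentIntegral F (δ' • z') (δ' • w') = segmentIntegral F z' w' := by
      intro δ' hδ' z' w'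
      have hdet : 0 < δ'.det.val := by rw [Subgroup.HasDetOne.det_eq hδ', Units.val_one]; exact one_pos
      have h := CartanDegree.segmentIntegral_slash_inv_smul F hdet (δ' • z') w'
      rw [inv_smul_smul, SlashInvariantForm.slash_action_eqn F δ' hδ'] at h
      exact h.symm
    have hinvP : ∀ i, segmentIntegral F z ((δ i)⁻¹ • z) = -segmentIntegral F z (δ i • z) := by
      intro i
      have h1 := hinv (hδ i) ((δ i)⁻¹ • z) z
      rw [smul_inv_smul] at h1
      have h2 := segmentIntegral_sub_segmentIntegral F z ((δ i)⁻¹ • z) z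
      have e0 := segmentIntegral_sub_segmentIntegral F z z z
      rw [sub_self] at e0
      linear_combination h1 - h2 - e0
    have hsum : (L.map ((fun g => segmentIntegral F z (g • z)) ∘ fun i => (δ i)⁻¹)).sum = -∑ i, segmentIntegral F z (δ i • z) := by
      rw [hLdef]
      have : ((fun g => segmentIntegral F z (g • z)) ∘ fun i => (δ i)⁻¹) = fun i => -segmentIntegral F z (δ i • z) := by
        funext i; exact hinvP i
      rw [this, Finset.sum_map_toList, Finset.sum_neg_distrib]
    rw [hsum, nsmul_eq_mul, ← sub_eq_add_neg] at hP
    exact hP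
  · intro g hg
    rw [List.mem_append, List.mem_replicate, List.mem_reverse, List.mem_map] at hg
    rcases hg with ⟨-, rfl⟩ | ⟨i, -, rfl⟩
    · exact hγ
    · exact inv_mem (hδ i)

end Eisenstein

end Summit.BirchSwinnertonDyer.BirchSwinnertonDyer.Theorems.CartanCover

end
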